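import Literature.NumberTheory.Sieve.HeathBrownCubicETermRearrangement
import Literature.NumberTheory.Sieve.HeathBrownCubicIdealMoebius
import HarnessLib

/-!
# Heath-Brown's (8.7): the main terms of Lemma 8.1 rearranged by `I = (J, q)`

Layer of the decomposition of **parity.S18**
(`Literature.NumberTheory.Sieve.setOf_prime_cube_add_two_mul_cube_infinite`) along D. R. Heath-Brown,
*Primes represented by `x³ + 2y³`*, Acta Math. 186 (2001), 1–84, inside the proof of **Lemma 8.1**.
After (8.1) and (8.5) the sum `∑_{β ≡ α (mod q), β̂ ∈ 𝒞} e_(β)` has main term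
`M⁻¹(ξ log X)^{−n−1} 𝓘 ∑_{N(J) < L, (J,q) ∣ α} μ(J) log(L/N(J))/N([J, q])` (p. 50), and

> "We write `I = (J, q)` so that [the sum becomes] `∑_{I ∣ q, α} … ∑_{A ∣ qI⁻¹} …` (8.7). To handle the
> innermost sum we therefore investigate `Σ = ∑_{N(B) < x, (B, C) = 1} μ(B) log(x/N(B))/N(B)`" (pp. 50–51).

This file PROVES the rearrangement in the closed form that the analytic evaluation of `Σ` consumes,
**`sum_moebius_main_eq`**: for `q ≥ 1`, `𝔮 = (q)` (so `N([J, q]) = N(J ∩ 𝔮)`, `(J, q) = J + 𝔮`) and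
every real `L`,
`∑_{N(J) < L} μ(J) log(L/N(J)) [α ∈ J + 𝔮] / N(J ∩ 𝔮) = q⁻³ ∑_{I ∣ 𝔮, α ∈ I} μ(I) ∑_{N(A) < L/N(I), A + 𝔮 = (1)} μ(A) log((L/N(I))/N(A))/N(A)`:
drop `J = 0` (`μ(0) = 0`); `1/N(J ∩ 𝔮) = N(J + 𝔮)/(N(J)q³)` (`absNorm_inf_mul_absNorm_sup`); sort `J`
by `I = J + 𝔮 ∣ 𝔮`; in the fibre of `I` substitute `J = IA` (a bijection with the `A ≠ 0`,
`N(A) < L/N(I)`, `IA + 𝔮 = I`); finally `μ(IA)[IA + 𝔮 = I] = μ(I)μ(A)[A + 𝔮 = (1)]`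
(`idealMoebius_mul_ite_eq`: the square-freeness of `J` forces `(A, I) = 1`, which together with
`(A, 𝔮I⁻¹) = 1` is `(A, 𝔮) = 1`). With `∑_{I ∣ 𝔮, α ∈ I} μ(I) = ε(α, q)` (`sum_filter_mem_idealMoebius`,
`coprimeInd_eq_ite_sup` of `HeathBrownCubicIdealMoebius`) this reduces the main term of Lemma 8.1 to the
Möbius sums `Σ(x; 𝔮)`, whose evaluation `γ₀⁻¹N(𝔮)/φ_K(𝔮) + O(exp(−c√(log x)))` (Perron's formula and the
zero-free region of `ζ_K`, p. 51) is NOT in this file.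

## References

* D. R. Heath-Brown, *Primes represented by `x³ + 2y³`*, Acta Math. 186 (2001), 1–84: §8, (8.7) and
  the surrounding text (pp. 50–51). [cite: HeathBrownActa2001, §8 (8.7)]

## Mathlib / tree search

Mathlib: `Finset.sum_fiberwise_of_maps_to`, `Finset.sum_nbij'`, `mul_left_cancel₀`, `Ideal.dvd_iff_le`,
`map_mul` (`Ideal.absNorm`). Tree: `HeathBrownCubicETermRearrangement` (`smallIdeals`, `mem_smallIdeals_iff`),
`HeathBrownCubicIdealMoebius` (`idealMoebius_bot`, `absNorm_cast_pos`, `absNorm_inf_mul_absNorm_sup`,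
`idealMoebius_mul_ite_eq`), `HeathBrownCubicTypeII` (`idealDivisors`, `mem_idealDivisors_iff`, `idealMoebius`),
`HeathBrownCubicSiegelWalfisz` (`absNorm_span_natCast_K`).
-/

noncomputable section

open Polynomial NumberField Finset

namespace Literature.NumberTheory.Sieve.CubicSieve

open LFunctions.CubeRootTwoField CubicPrimes

section MainTerm

open scoped Classical in
/-- **The main terms of (8.1) rearranged as in (8.7)** (p. 50: "We write `I = (J, q)` so that …
`= ∑_{I ∣ q, α} μ(I) ∑_{A ∣ qI⁻¹} …`", with `N([J, q]) = N(J)N(q)/N((J, q))`): for `q ≥ 1`, `𝔮 = (q)`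
and any real `L`,
`∑_{N(J) < L} μ(J) log(L/N(J)) [α ∈ J + 𝔮] / N(J ∩ 𝔮) = q⁻³ ∑_{I ∣ 𝔮, α ∈ I} μ(I) ∑_{N(A) < L/N(I), A + 𝔮 = (1)} μ(A) log((L/N(I))/N(A)) / N(A)`
(substituting `J = IA` with `I = J + 𝔮`; the square-freeness of `J` forces `(A, I) = 1`, which with
`(A, 𝔮I⁻¹) = 1` is `(A, 𝔮) = 1`, `idealMoebius_mul_ite_eq`). [cite: HeathBrownActa2001, §8 (8.7)] -/
theorem sum_moebius_main_eq {q : ℕ} (hq : 0 < q) (L : ℝ) (α : 𝓞 K) :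
    ∑ J ∈ smallIdeals L, idealMoebius J * Real.log (L / Ideal.absNorm J) *
        (if α ∈ J ⊔ Ideal.span {(q : 𝓞 K)} then ((Ideal.absNorm (J ⊓ Ideal.span {(q : 𝓞 K)}) : ℝ))⁻¹ else 0) =
      ((q : ℝ) ^ 3)⁻¹ * ∑ I ∈ (idealDivisors (Ideal.span {(q : 𝓞 K)})).filter (fun I => α ∈ I),
        idealMoebius I * ∑ A ∈ (smallIdeals (L / Ideal.absNorm I)).filter
            (fun A => A ⊔ Ideal.span {(q : 𝓞 K)} = ⊤),
          idealMoebius A * Real.log (L / Ideal.absNorm I / Ideal.absNorm A) / Ideal.absNorm A := by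
  set 𝔮 : Ideal (𝓞 K) := Ideal.span {(q : 𝓞 K)} with h𝔮
  have h𝔮0 : 𝔮 ≠ ⊥ := by
    rw [h𝔮, Ne, Ideal.span_singleton_eq_bot]; exact_mod_cast hq.ne'
  have hN𝔮 : (Ideal.absNorm 𝔮 : ℝ) = (q : ℝ) ^ 3 := by
    rw [h𝔮, absNorm_span_natCast_K]; push_cast; ring
  have hq3 : (0 : ℝ) < (q : ℝ) ^ 3 := by positivity
  set D := (idealDivisors 𝔮).filter (fun I => α ∈ I) with hD
  -- Step 1: drop `J = ⊥` and open the indicator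
  set S := (smallIdeals L).filter (fun J => J ≠ ⊥ ∧ α ∈ J ⊔ 𝔮) with hS
  set F : Ideal (𝓞 K) → ℝ := fun J => idealMoebius J * Real.log (L / Ideal.absNorm J) *
    ((Ideal.absNorm (J ⊔ 𝔮) : ℝ) / ((Ideal.absNorm J : ℝ) * (q : ℝ) ^ 3)) with hF
  have step1 : ∑ J ∈ smallIdeals L, idealMoebius J * Real.log (L / Ideal.absNorm J) *
        (if α ∈ J ⊔ 𝔮 then ((Ideal.absNorm (J ⊓ 𝔮) : ℝ))⁻¹ else 0) = ∑ J ∈ S, F J := by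
    rw [hS, Finset.sum_filter]
    refine Finset.sum_congr rfl fun J _ => ?_
    by_cases hJ : J = ⊥
    · simp [hJ, idealMoebius_bot]
    · by_cases hα : α ∈ J ⊔ 𝔮
      · rw [if_pos hα, if_pos ⟨hJ, hα⟩, hF]
        simp only
        congr 1
        -- `N(J ⊓ 𝔮)⁻¹ = N(J ⊔ 𝔮) / (N(J) q³)`
        have hmul := absNorm_inf_mul_absNorm_sup J 𝔮
        have hmulR : (Ideal.absNorm (J ⊓ 𝔮) : ℝ) * (Ideal.absNorm (J ⊔ 𝔮) : ℝ) =
            (Ideal.absNorm J : ℝ) * (q : ℝ) ^ 3 := by rw [← hN𝔮]; exact_mod_cast hmul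
        have hinf0 : (0 : ℝ) < Ideal.absNorm (J ⊓ 𝔮) := by
          refine absNorm_cast_pos fun h => ?_
          have : J * 𝔮 ≤ J ⊓ 𝔮 := Ideal.mul_le_inf
          rw [h, le_bot_iff, Ideal.mul_eq_bot] at this
          exact this.elim hJ h𝔮0
        have hJ0 : (0 : ℝ) < Ideal.absNorm J := absNorm_cast_pos hJ
        field_simp
        linarith [hmulR]
      · rw [if_neg hα, if_neg (fun h => hα h.2), mul_zero]
  -- Step 3: fibres over `I = J ⊔ 𝔮 ∈ D`
  have hmaps : ∀ J ∈ S, J ⊔ 𝔮 ∈ D := by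
    intro J hJ
    rw [hS, Finset.mem_filter] at hJ
    rw [hD, Finset.mem_filter, mem_idealDivisors_iff h𝔮0]
    exact ⟨Ideal.dvd_iff_le.mpr le_sup_right, hJ.2.2⟩
  rw [step1, ← Finset.sum_fiberwise_of_maps_to hmaps, Finset.mul_sum]
  refine Finset.sum_congr rfl fun I hI => ?_
  rw [hD, Finset.mem_filter, mem_idealDivisors_iff h𝔮0] at hI
  obtain ⟨hI𝔮, hαI⟩ := hI
  have hI0 : I ≠ ⊥ := by rintro rfl; exact h𝔮0 (zero_dvd_iff.mp hI𝔮)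
  have hNI : (0 : ℝ) < Ideal.absNorm I := absNorm_cast_pos hI0
  -- Step 4: the fibre over `I` is `{I A}`; Step 5: the pointwise identity
  set T := (smallIdeals (L / Ideal.absNorm I)).filter (fun A => A ≠ ⊥ ∧ I * A ⊔ 𝔮 = I) with hT
  set g : Ideal (𝓞 K) → ℝ := fun A => Real.log (L / Ideal.absNorm I / Ideal.absNorm A) / Ideal.absNorm A
    with hg
  have step4 : ∑ J ∈ S.filter (fun J => J ⊔ 𝔮 = I), F J =
      ∑ A ∈ T, ((q : ℝ) ^ 3)⁻¹ * (idealMoebius (I * A) * g A) := by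
    symm
    refine Finset.sum_nbij' (fun A => I * A) (fun J => if h : I ∣ J then Classical.choose h else ⊥)
      ?_ ?_ ?_ ?_ ?_
    · intro A hA
      rw [hT, Finset.mem_filter, mem_smallIdeals_iff] at hA
      obtain ⟨hAN, hA0, hAI⟩ := hA
      rw [Finset.mem_filter, hS, Finset.mem_filter, mem_smallIdeals_iff]
      refine ⟨⟨?_, mul_ne_zero hI0 hA0, by rw [hAI]; exact hαI⟩, hAI⟩
      rw [map_mul, Nat.cast_mul]
      calc (Ideal.absNorm I : ℝ) * Ideal.absNorm A < Ideal.absNorm I * (L / Ideal.absNorm I) :=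
            mul_lt_mul_of_pos_left hAN hNI
        _ = L := by field_simp
    · intro J hJ
      rw [Finset.mem_filter, hS, Finset.mem_filter, mem_smallIdeals_iff] at hJ
      obtain ⟨⟨hJN, hJ0, -⟩, hJI⟩ := hJ
      have hdvd : I ∣ J := Ideal.dvd_iff_le.mpr (hJI ▸ le_sup_left)
      rw [dif_pos hdvd]
      have hspec := Classical.choose_spec hdvd
      set A := Classical.choose hdvd
      have hA0 : A ≠ ⊥ := by rintro h; rw [h, Ideal.mul_bot] at hspec; exact hJ0 hspec
      rw [hT, Finset.mem_filter, mem_smallIdeals_iff]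
      refine ⟨?_, hA0, by rw [← hspec, hJI]⟩
      rw [lt_div_iff₀ hNI, mul_comm]
      have : (Ideal.absNorm J : ℝ) = Ideal.absNorm I * Ideal.absNorm A := by
        rw [hspec, map_mul, Nat.cast_mul]
      rwa [this] at hJN
    · intro A _
      have hdvd : I ∣ I * A := dvd_mul_right I A
      rw [dif_pos hdvd]
      exact mul_left_cancel₀ hI0 (Classical.choose_spec hdvd).symm
    · intro J hJ
      rw [Finset.mem_filter, hS, Finset.mem_filter] at hJ
      have hdvd : I ∣ J := Ideal.dvd_iff_le.mpr (hJ.2 ▸ le_sup_left)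
      simp only [dif_pos hdvd]
      exact (Classical.choose_spec hdvd).symm
    · intro A hA
      rw [hT, Finset.mem_filter] at hA
      obtain ⟨-, hA0, hAI⟩ := hA
      have hNA : (0 : ℝ) < Ideal.absNorm A := absNorm_cast_pos hA0
      simp only [hF, hg, hAI, map_mul, Nat.cast_mul]
      rw [div_div]
      field_simp
  have step5 : ∑ A ∈ T, ((q : ℝ) ^ 3)⁻¹ * (idealMoebius (I * A) * g A) =
      ((q : ℝ) ^ 3)⁻¹ * (idealMoebius I *
        ∑ A ∈ (smallIdeals (L / Ideal.absNorm I)).filter (fun A => A ⊔ 𝔮 = ⊤), idealMoebius A * g A) := by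
    rw [hT, Finset.sum_filter, Finset.sum_filter, Finset.mul_sum, Finset.mul_sum]
    refine Finset.sum_congr rfl fun A _ => ?_
    have key := idealMoebius_mul_ite_eq hI0 hI𝔮 A
    have e1 : (if A ≠ ⊥ ∧ I * A ⊔ 𝔮 = I then ((q : ℝ) ^ 3)⁻¹ * (idealMoebius (I * A) * g A) else 0) =
        ((q : ℝ) ^ 3)⁻¹ * g A * (if A ≠ ⊥ ∧ I * A ⊔ 𝔮 = I then idealMoebius (I * A) else 0) := by
      split_ifs <;> ring
    rw [e1, key]
    split_ifs <;> ring
  rw [step4, step5]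
  simp only [hg]
  congr 1
  congr 1
  refine Finset.sum_congr rfl fun A _ => ?_
  ring

end MainTerm

end Literature.NumberTheory.Sieve.CubicSieve

end
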